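import Summits.QuantumFields.YangMills.Theorems.BalabanUVNodesN16Thm4ZdPrintOfLeaf
import Summits.QuantumFields.YangMills.Theorems.BalabanUVNodesN16Thm4TorusOfZd
import HarnessLib

/-!
# Route «BalabanUVNodes» (K3 `SpineGivenEndpointR11`), DAG node N16 = NE3 — N16 ∕ NE3 FROM NODE N05's LEAF IN N05's OWN CURRENCY:
# `B8.Thm4Body ∧ B8.Prop3Body` on n05-a's family `zdGF3 (Matrix n n ℂ) L β len` over the univ sub-index, at `η = L^{−k}`, `d = 4`,
# composed with files 4b (leaf ⟹ `ℤᵈ` reading), 2 (periodicity principle) and n16-a's file 13 (edge of record) — plus the letter window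

Cell `pub-ymgap`, seat `pub-ymgap-dag-n16-c` (R134 fan-out seat, strategy s1; HUMAN RULING D-0062; chair R424 venue), generation 0, file 5;
`--supports stmt-QuantumFields-19676`; `bears_on: R4∕N16 · edge N05 → N16`.

WHY.  Files 3–4b turned N05's leaf statements (the Theorem-4 and Proposition-3 clauses of `B8.Thm4Body` ∕ `B8.Prop3Body` at the all-torus
member of `zdGF3`) into `Thm4TorusAt L k 0 η c₁′ … Concl_P` with print's (1.36)∕(1.38)∕(1.39) list weighted by `(Lᵏη)^{−n}`; file 2 turned the
period-`0` interface with the UNWEIGHTED list Concl⁰_print at `η = L^{−k}` into N16's binder and N16's statement of record (`n16_of_thm4Zd_print`,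
`d = 4`).  THIS FILE closes the remaining letter gap: at `η = L^{−k}` the weights are `1`, the nearest-neighbour pairs are admissible for a
length function with `len e_μ = 1` once `η ≤ 1`, and `R(U₀(y,μ)) = Ad_{U₀(y,μ)}` on matrices — so Concl_P IS Concl⁰_print (§2) —, and the
eleven-line smallness window of file 4b is inhabited below an explicit positive threshold (§1).  The result (§3) is THE EDGE N05 → N16 WITH
N05's SIDE IN N05's OWN TYPED CURRENCY: `B8.Thm4Body c₁ B₁′` and `B8.Prop3Body cP 4 L C₂ inp B₀β` on `fun i ↦ zdGF3 (M_n(ℂ)) L 1 len i.1` over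
`{i // i.Ω 0 = univ}` (n05-a's `thm4Printed_zd3` ∕ `prop3Printed_zd3` restricted to the univ sub-family deliver exactly these, modulo their
sockets) + N07's (H3ˢᵘᵖ) ⟹ `NE3EnergyRateWCov 4 (sfClass 4 L N ε) L N b g C s₁ s₂ dom`.

WHAT THIS FILE PROVES (kernel, theorems only, 0 `def`, 0 sorry):
§1 `exists_window_print` (`d, L ≥ 2`, `c₁, cP, B₁′ > 0`, any `C₂`): a threshold `c₁′ > 0` below which the window `hwin` of file 4b holds
   (Proposition 3's window `B8LeafModelZd3.prop3_windows` at `α₀` and `2α₀`, the (1.61) line, `dLα₁ ≤ ⅛`).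
§2 `thm4TorusAt_concl_congr` (the interface is extensional in its conclusion slot) and **`thm4TorusAt_print_of_leaf`** (matrices `M_n(ℂ)` with
   the `L²`-operator-norm C⋆-structure assembled in the statement, any `d ≥ 2`, `L ≥ 2`, `β ≥ 0`, `len ≥ 1` on its support with `len e_μ = 1`):
   the two leaf clauses on the univ sub-family + the window ⟹ `∀ k ≥ 1`, `Thm4TorusAt L k 0 (Lᵏ)⁻¹ c₁′ unitaryUnits Reg (Restr129 L k (torusLam k))
   Concl⁰_print` — file 2 §3's hypothesis VERBATIM (`B = 5dLB₀`, `B_h = 5dLB₀(β₀)`).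
§3 **`n16_of_leaf`** (`d = 4`, `L ≥ 2`, `N ≥ 1`, `β₀ = 1`): file 2's `n16_of_thm4Zd_print` with (T4^ℤᵈ_print) REPLACED by the two leaf clauses
   and the window (`B := 5·4·L·B₀`, `B_h := 5·4·L·B₀(β₀)`, `20LB₀ ≤ B₁′`).
HONEST FRAMING: bookkeeping by name; the leaf clauses = [Balaban1985RegularSpaces] Thm 4 + Prop 3 at CURVED backgrounds on the `ℤᵈ` carriers
= node N05's theorems (in the tree only modulo n05-a's sockets `SockP5base ∕ SockP5 ∕ SockH59 ∕ SockP5u ∕ SockB9P3`), (H3ˢᵘᵖ) = N07's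
[Balaban1985Variational] Thm 1 TYPE; N16 ∕ NE3 NOT discharged; count-neutral; finite T⁴ at fixed ε — NOT ℝ⁴, NOT infinite volume, NOT OS,
NOT a mass gap, NOT Clay.
-/

set_option autoImplicit false

open scoped BigOperators Matrix Matrix.Norms.L2Operator
open NormedSpace

namespace Summit.QuantumFields.YangMills.BalabanUVNodes.N16.OfLeaf

open Literature.MathematicalPhysics.QuantumFieldTheory.Balaban1983to89
open B7Prop1Explicit B7Prop2Explicit
open B7Prop3Flat (c3)
open B7Eq78Linearization (conjR)
open B7Eq92Concrete (mgauge)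
open B8Ineq132 (InAk covDerivFwd)
open B8Eq184Proof (cfgExp)
open B8Eq119TwistedAxial (Restr129)
open B8Eq133Hypotheses (Reg335Zd)
open B8Eq138LandauZd (IsLandau138 covLap)
open B9Eq340HolderZd (AdmPair mem_admPair)
open B8Thm4TorusAt (torusLam Thm4TorusAt)
open B8LeafModelZd (ZdIdx)
open B8LeafModelZd3 (zdGF3 prop3_windows)
open B12Ineq417Flat (shiftCfg)
open Summit.QuantumFields.BalabanUV.T4Continuum
open T4AveragingDeficitWall (Ad)
open BlockAverageCurrent (curConst)
open NE3EnergyWeightedCovShape (NE3EnergyRateWCov)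
open NE3RightInverseSupLetters (frameC)
open NE3.LeafIndexSockets (LeafH3sup)
open MinimalActionRate (sfClass)
open Thm4ZdPrintOfLeaf (thm4TorusAt_zero_print_of_leaf_univ)

noncomputable section

variable {d : ℕ}

/-! ## §1 The letter window of file 4b is inhabited -/

/-- **THE WINDOW IS NOT EMPTY.**  For `d, L ≥ 2`, `c₁, cP, B₁′ > 0` and any `C₂` there is `c₁′ > 0` such that `0 < α₀, α₁`, `α₀ + α₁ ≤ c₁′` place
`(α₀, α₁, α₂ := B₁′(α₀+α₁))` inside Theorem 4's threshold, Proposition 2's window at `2α₀`, the (1.42)-lemma's and Proposition 3's windows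
(`B8LeafModelZd3.prop3_windows`), the (1.61) line and `dLα₁ ≤ ⅛` («α₀, α₁, α₂ bounded by a constant depending on d and L only»).
[cite: Balaban1985RegularSpaces, Prop. 3 p.87, (1.61) p.86, Thm 4 p.88 («There exists a constant c₁»)] -/
theorem exists_window_print (hd2 : 2 ≤ d) {L : ℕ} (hL : 2 ≤ L) {c₁ cP B₁' : ℝ} (C₂ : ℝ) (hc₁ : 0 < c₁) (hcP : 0 < cP)
    (hB₁' : 0 < B₁') :
    ∃ c₁' : ℝ, 0 < c₁' ∧ ∀ α₀ α₁ : ℝ, 0 < α₀ → 0 < α₁ → α₀ + α₁ ≤ c₁' →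
      α₀ + α₁ ≤ c₁ ∧ C0 d * (2 * α₀) ≤ 1 / 3 ∧ 4 * α₀ ≤ c2' d L ∧ 16 * (B₁' * (α₀ + α₁)) ≤ 1 ∧
      Real.exp (4 * (800 * ((d : ℝ) + 1) ^ 2 * ((d : ℝ) + 4)) * α₀) * (1 + 8 * (131072 * ((d : ℝ) + 1) ^ 2) * (B₁' * (α₀ + α₁))) ≤ 2 ∧
      2 * (B₁' * (α₀ + α₁)) ≤ c3 d L ∧ (d : ℝ) * L * α₁ ≤ 1 / 8 ∧ α₀ ≤ cP ∧ α₁ ≤ cP ∧ B₁' * (α₀ + α₁) ≤ cP ∧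
      2 * (B₁' * (α₀ + α₁)) ^ 2 + 20 * d * α₀ * (B₁' * (α₀ + α₁)) + 2 * C₂ * (B₁' * (α₀ + α₁)) ^ 2 ≤ α₀ + α₁ := by
  obtain ⟨c, hc, hw⟩ := prop3_windows hd2 hL (le_refl (0 : ℝ))
  have hd0 : (0 : ℝ) < d := by exact_mod_cast lt_of_lt_of_le (by norm_num) hd2
  have hL0 : (0 : ℝ) < L := by exact_mod_cast lt_of_lt_of_le (by norm_num) hL
  set K : ℝ := B₁' ^ 2 * (2 + 2 * |C₂|) + 20 * d * B₁' with hK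
  have hK0 : 0 ≤ K := by positivity
  set t : ℝ := min (min c₁ cP) (min (min (c / 2) (min c cP / B₁')) (min (1 / (8 * (d * L))) (1 / (K + 1)))) with ht
  have ht0 : 0 < t := by
    refine lt_min (lt_min hc₁ hcP) (lt_min (lt_min (by positivity) ?_) (lt_min (by positivity) (by positivity)))
    exact div_pos (lt_min hc hcP) hB₁'
  have h₁ : t ≤ c₁ := (min_le_left _ _).trans (min_le_left _ _)
  have h₂ : t ≤ cP := (min_le_left _ _).trans (min_le_right _ _)
  have h₃ : t ≤ c / 2 := (min_le_right _ _).trans ((min_le_left _ _).trans (min_le_left _ _))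
  have h₄ : t ≤ min c cP / B₁' := (min_le_right _ _).trans ((min_le_left _ _).trans (min_le_right _ _))
  have h₅ : t ≤ 1 / (8 * (d * L)) := (min_le_right _ _).trans ((min_le_right _ _).trans (min_le_left _ _))
  have h₆ : t ≤ 1 / (K + 1) := (min_le_right _ _).trans ((min_le_right _ _).trans (min_le_right _ _))
  refine ⟨t, ht0, fun α₀ α₁ hα₀ hα₁ hs => ?_⟩
  have hs0 : 0 < α₀ + α₁ := by linarith
  -- `α₂ = B₁′(α₀+α₁) ≤ min c cP`
  have hα₂ : B₁' * (α₀ + α₁) ≤ min c cP := by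
    have h := mul_le_mul_of_nonneg_left (hs.trans h₄) hB₁'.le
    have e : B₁' * (min c cP / B₁') = min c cP := by field_simp
    rwa [e] at h
  have hα₂c : B₁' * (α₀ + α₁) ≤ c := hα₂.trans (min_le_left _ _)
  have hα₂P : B₁' * (α₀ + α₁) ≤ cP := hα₂.trans (min_le_right _ _)
  have hα₂0 : 0 ≤ B₁' * (α₀ + α₁) := by positivity
  -- Proposition 3's window at `α₀` and at `2α₀`
  obtain ⟨-, hα4, h16, -, hsmall, hc₃, -, -, -⟩ := hw α₀ (B₁' * (α₀ + α₁)) hα₀ (by linarith) hα₂0 hα₂c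
  obtain ⟨hC0, -, -, -, -, -, -, -, -⟩ := hw (2 * α₀) (B₁' * (α₀ + α₁)) (by linarith) (by linarith) hα₂0 hα₂c
  refine ⟨hs.trans h₁, hC0, hα4, h16, hsmall, hc₃, ?_, by linarith, by linarith, hα₂P, ?_⟩
  · -- `dLα₁ ≤ 1/8`
    have hα₁t : α₁ ≤ 1 / (8 * (d * L)) := by linarith
    have hdl : (0 : ℝ) < d * L := by positivity
    calc (d : ℝ) * L * α₁ ≤ d * L * (1 / (8 * (d * L))) := mul_le_mul_of_nonneg_left hα₁t hdl.le
      _ = 1 / 8 := by field_simp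
  · -- the (1.61) line
    have hsK : (α₀ + α₁) * (K + 1) ≤ 1 := by
      have h := mul_le_mul_of_nonneg_right (hs.trans h₆) (by positivity : (0 : ℝ) ≤ K + 1)
      rwa [one_div, inv_mul_cancel₀ (by positivity : (K : ℝ) + 1 ≠ 0)] at h
    have hC₂ : C₂ ≤ |C₂| := le_abs_self C₂
    have hα₀s : α₀ ≤ α₀ + α₁ := by linarith
    calc 2 * (B₁' * (α₀ + α₁)) ^ 2 + 20 * d * α₀ * (B₁' * (α₀ + α₁)) + 2 * C₂ * (B₁' * (α₀ + α₁)) ^ 2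
        ≤ 2 * (B₁' * (α₀ + α₁)) ^ 2 + 20 * d * (α₀ + α₁) * (B₁' * (α₀ + α₁)) + 2 * |C₂| * (B₁' * (α₀ + α₁)) ^ 2 := by
          gcongr
      _ = (α₀ + α₁) * ((α₀ + α₁) * K) := by rw [hK]; ring
      _ ≤ (α₀ + α₁) * 1 := by
          refine mul_le_mul_of_nonneg_left ?_ hs0.le
          nlinarith
      _ = α₀ + α₁ := mul_one _

/-! ## §2 At `η = L^{−k}` on matrices: the leaf clauses give file 2's (T4^ℤᵈ_print) verbatim -/

section Congr

variable {𝔸 : Type*} [NormedRing 𝔸] [NormedAlgebra ℂ 𝔸] [CompleteSpace 𝔸]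

/-- **`Thm4TorusAt` IS EXTENSIONAL IN ITS CONCLUSION SLOT**: pointwise equivalent conclusions give the same interface. [folklore] -/
theorem thm4TorusAt_concl_congr {L k : ℕ} {P : ℤ} {η c₁ : ℝ} {G : Subgroup 𝔸ˣ} {Reg : (Site d → Fin d → 𝔸ˣ) → Prop}
    {Restr : (Site d → Fin d → 𝔸ˣ) → (Site d → 𝔸ˣ) → Prop}
    {C₁ C₂ : ℝ → ℝ → (Site d → Fin d → 𝔸ˣ) → (Site d → Fin d → 𝔸ˣ) → (Site d → 𝔸ˣ) → Prop}
    (h : ∀ α₀ α₁ U₀ U' u, C₁ α₀ α₁ U₀ U' u ↔ C₂ α₀ α₁ U₀ U' u) (hT : Thm4TorusAt L k P η c₁ G Reg Restr C₁) :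
    Thm4TorusAt L k P η c₁ G Reg Restr C₂ := by
  have hC : C₁ = C₂ := by
    funext α₀ α₁ U₀ U' u
    exact propext (h α₀ α₁ U₀ U' u)
  subst hC
  exact hT

end Congr

section Matrices

variable {n : Type} [Fintype n] [DecidableEq n]

/-- **THE LEAF CLAUSES ⟹ FILE 2's (T4^ℤᵈ_print), VERBATIM** (`𝔸 = M_n(ℂ)` with the `L²`-operator-norm C⋆-structure assembled in the statement;
`d, L ≥ 2`; Hölder data `β ≥ 0`, `len ≥ 1` on its support and `len e_μ = 1`; constants and window as in file 4b): `B8.Thm4Body c₁ B₁′` and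
`B8.Prop3Body cP d L C₂ inp B₀β` on `fun i ↦ zdGF3 (M_n(ℂ)) L β len i.1` over `{i // i.Ω 0 = univ}` give, at EVERY `k ≥ 1` and for every `Reg`,
`Thm4TorusAt L k 0 (Lᵏ)⁻¹ c₁′ unitaryUnits Reg (Restr129 L k (torusLam k)) Concl⁰_print` with `B = 5dLB₀`, `B_h = 5dLB₀(β₀)` — file 4b at `η = L^{−k}`,
where `Lᵏη = 1` kills the weights, `(y, y + e_μ)` is admissible and `R(U₀(y,μ)) = Ad_{U₀(y,μ)}`.
[cite: Balaban1985RegularSpaces, Thm 4 p.88, Prop. 3 p.87, (1.36)–(1.39) pp.82–83, p.77 («Ω_j = T_η»)] -/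
theorem thm4TorusAt_print_of_leaf [Nonempty n] (hd2 : 2 ≤ d) {L : ℕ} (hL : 2 ≤ L) {β : ℝ} (hβ : 0 ≤ β) {len : Site d → ℝ}
    (hlen : ∀ v : Site d, 0 < len v → 1 ≤ len v) (hlen1 : ∀ μ : Fin d, len (e μ) = 1) {c₁ c₁' B₁' cP C₂ B₀β : ℝ} {inp : B8.B9Inputs}
    (hB₁' : 0 < B₁') (hBB : 5 * (d : ℝ) * L * inp.B₀ ≤ B₁')
    (hwin : ∀ α₀ α₁ : ℝ, 0 < α₀ → 0 < α₁ → α₀ + α₁ ≤ c₁' →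
      α₀ + α₁ ≤ c₁ ∧ C0 d * (2 * α₀) ≤ 1 / 3 ∧ 4 * α₀ ≤ c2' d L ∧ 16 * (B₁' * (α₀ + α₁)) ≤ 1 ∧
      Real.exp (4 * (800 * ((d : ℝ) + 1) ^ 2 * ((d : ℝ) + 4)) * α₀) * (1 + 8 * (131072 * ((d : ℝ) + 1) ^ 2) * (B₁' * (α₀ + α₁))) ≤ 2 ∧
      2 * (B₁' * (α₀ + α₁)) ≤ c3 d L ∧ (d : ℝ) * L * α₁ ≤ 1 / 8 ∧ α₀ ≤ cP ∧ α₁ ≤ cP ∧ B₁' * (α₀ + α₁) ≤ cP ∧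
      2 * (B₁' * (α₀ + α₁)) ^ 2 + 20 * d * α₀ * (B₁' * (α₀ + α₁)) + 2 * C₂ * (B₁' * (α₀ + α₁)) ^ 2 ≤ α₀ + α₁)
    (Reg : ℕ → (Site d → Fin d → (Matrix n n ℂ)ˣ) → Prop) :
    letI : CStarAlgebra (Matrix n n ℂ) := {}
    B8.Thm4Body c₁ B₁' (fun i : {i : ZdIdx d L // i.Ω 0 = Set.univ} => (zdGF3 (Matrix n n ℂ) L β len i.1).toGFData) →
    B8.Prop3Body cP d (L : ℝ) C₂ inp B₀β (fun i : {i : ZdIdx d L // i.Ω 0 = Set.univ} => (zdGF3 (Matrix n n ℂ) L β len i.1).toGFData2) →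
    ∀ k, 1 ≤ k → Thm4TorusAt L k 0 (((L : ℝ) ^ k)⁻¹) c₁' (unitaryUnits (Matrix n n ℂ)) (Reg k) (Restr129 L k (torusLam k))
      (fun (α₀ α₁ : ℝ) (U₀ U' : Site d → Fin d → (Matrix n n ℂ)ˣ) (u : Site d → (Matrix n n ℂ)ˣ) =>
        ∃ A : Site d → Fin d → Matrix n n ℂ,
          (∀ x μ, IsSelfAdjoint (A x μ)) ∧ mgauge U₀ u (cfgExp (((L : ℝ) ^ k)⁻¹) A) = U' ∧
          (∀ x μ, ‖A x μ‖ ≤ 5 * (d : ℝ) * L * inp.B₀ * (α₀ + α₁)) ∧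
          (∀ (μ : Fin d) (x : Site d) (κ : Fin d),
            ‖covDerivFwd (((L : ℝ) ^ k)⁻¹) U₀ μ (fun z => A z κ) x‖ ≤ 5 * (d : ℝ) * L * inp.B₀ * (α₀ + α₁)) ∧
          IsLandau138 L k (((L : ℝ) ^ k)⁻¹) Set.univ (torusLam k) U₀ A ∧
          (∀ (μ : Fin d) (y : Site d) (κ : Fin d),
            ‖Ad (U₀ y μ) (covDerivFwd (((L : ℝ) ^ k)⁻¹) U₀ μ (fun z => A z κ) (y + e μ))
                - covDerivFwd (((L : ℝ) ^ k)⁻¹) U₀ μ (fun z => A z κ) y‖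
              ≤ 5 * (d : ℝ) * L * B₀β * (α₀ + α₁) * (((L : ℝ)⁻¹) ^ k) ^ β) ∧
          (∀ (x : Site d) (κ : Fin d), ‖covLap (((L : ℝ) ^ k)⁻¹) U₀ (fun z => A z κ) x‖ ≤ 5 * (d : ℝ) * L * inp.B₀ * (α₀ + α₁))) := by
  letI : CStarAlgebra (Matrix n n ℂ) := {}
  intro hT hP k hk
  have hL1 : 1 ≤ L := le_trans (by norm_num) hL
  have hL1r : (1 : ℝ) ≤ L := by exact_mod_cast hL1
  have hLk : (1 : ℝ) ≤ (L : ℝ) ^ k := one_le_pow₀ hL1r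
  have hη : 0 < ((L : ℝ) ^ k)⁻¹ := by positivity
  have hη1 : ((L : ℝ) ^ k)⁻¹ ≤ 1 := inv_le_one_of_one_le₀ hLk
  have h := thm4TorusAt_zero_print_of_leaf_univ hd2 hL hβ hlen hB₁' hBB hwin hT hP hk hη (Reg k)
  refine thm4TorusAt_concl_congr (fun α₀ α₁ U₀ U' u => ?_) h
  -- the letter identities at `η = L^{-k}`
  have hw : (L : ℝ) ^ k * ((L : ℝ) ^ k)⁻¹ = 1 := mul_inv_cancel₀ (by positivity)
  have hw2 : ((L : ℝ) ^ k * ((L : ℝ) ^ k)⁻¹) ^ (-(2 : ℝ)) = 1 := by rw [hw, Real.one_rpow]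
  have hw3 : ((L : ℝ) ^ k * ((L : ℝ) ^ k)⁻¹) ^ (-(3 : ℝ)) = 1 := by rw [hw, Real.one_rpow]
  have hwβ : ((L : ℝ) ^ k * ((L : ℝ) ^ k)⁻¹) ^ (-(2 + β)) = 1 := by rw [hw, Real.one_rpow]
  have hηβ : ∀ μ : Fin d, (((L : ℝ) ^ k)⁻¹ * len (e μ)) ^ β = (((L : ℝ)⁻¹) ^ k) ^ β := fun μ => by
    rw [hlen1 μ, mul_one, inv_pow]
  have hadm : ∀ (μ : Fin d) (y : Site d), (y, y + e μ) ∈ AdmPair (((L : ℝ) ^ k)⁻¹) len := fun μ y => by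
    rw [mem_admPair]
    simp only [add_sub_cancel_left, hlen1 μ, mul_one]
    exact ⟨one_pos, hη1⟩
  constructor
  · rintro ⟨A, h1, h2, h3, h4, h5, h6, h7⟩
    refine ⟨A, h1, h2, fun x μ => ?_, fun μ x κ => ?_, h5, fun μ y κ => ?_, fun x κ => ?_⟩
    · have h := h3 x μ; rwa [hw, inv_one, mul_one] at h
    · have h := h4 μ x κ; rwa [hw2, mul_one] at h
    · have h := h6 μ y κ (hadm μ y); rwa [hwβ, mul_one, hηβ μ] at h
    · have h := h7 x κ; rwa [hw3, mul_one] at h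
  · rintro ⟨A, h1, h2, h3, h4, h5, h6, h7⟩
    refine ⟨A, h1, h2, fun x μ => ?_, fun μ x κ => ?_, h5, fun μ y κ _ => ?_, fun x κ => ?_⟩
    · rw [hw, inv_one, mul_one]; exact h3 x μ
    · rw [hw2, mul_one]; exact h4 μ x κ
    · rw [hwβ, mul_one, hηβ μ]; exact h6 μ y κ
    · rw [hw3, mul_one]; exact h7 x κ

/-! ## §3 N16 ∕ NE3 from node N05's leaf in its own currency and N07's interface (`d = 4`) -/

/-- **N16 · NE3 FROM THE [B8] LEAF ON THE UNIV SUB-FAMILY OF `zdGF3 (M_n(ℂ))` AND N07's (H3ˢᵘᵖ)** (`d = 4`, `L ≥ 2`, `N ≥ 1`, Hölder exponent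
`β₀ = 1`, a length function `len ≥ 1` on its support with `len e_μ = 1`): file 2's `n16_of_thm4Zd_print` with its N05-side hypothesis
(T4^ℤᵈ_print) REPLACED by `B8.Thm4Body c₁ B₁′` ∧ `B8.Prop3Body cP 4 L C₂ inp B₀β` on `fun i ↦ zdGF3 (M_n(ℂ)) L 1 len i.1` over `{i // i.Ω 0 = univ}`
(what n05-a's `thm4Printed_zd3` ∕ `prop3Printed_zd3` deliver, modulo their sockets), the letters `0 < B₁′`, `5·4·L·B₀ ≤ B₁′`, the window of
§1 at `c₁′`, and `16·(5·4·L·B₀)·c₁′ ≤ 1`; the Thm-4 output constants of file 2 are `B := 5·4·L·B₀`, `B_h := 5·4·L·B₀β`.  N16 ∕ NE3 NOT proved: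
the two leaf clauses are node N05's theorems, (H3ˢᵘᵖ) is N07's. [folklore] -/
theorem n16_of_leaf [Nonempty n] {L N : ℕ} (hL : 2 ≤ L) (hN : 1 ≤ N) :
    letI : CStarAlgebra (Matrix n n ℂ) := {}
    ∃ r : ℝ, 0 < r ∧ ∀ ⦃g : ℝ⦄, 0 < g → ∃ C : ℝ, 0 ≤ C ∧
      ∀ (c₁ c₁' B₁' cP C₂ B₀β : ℝ) (inp : B8.B9Inputs) (len : Site 4 → ℝ), (∀ v : Site 4, 0 < len v → 1 ≤ len v) →
      (∀ μ : Fin 4, len (e μ) = 1) → 0 < B₁' → 5 * ((4 : ℕ) : ℝ) * L * inp.B₀ ≤ B₁' → 16 * (5 * ((4 : ℕ) : ℝ) * L * inp.B₀ * c₁') ≤ 1 →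
      (∀ α₀ α₁ : ℝ, 0 < α₀ → 0 < α₁ → α₀ + α₁ ≤ c₁' →
        α₀ + α₁ ≤ c₁ ∧ C0 4 * (2 * α₀) ≤ 1 / 3 ∧ 4 * α₀ ≤ c2' 4 L ∧ 16 * (B₁' * (α₀ + α₁)) ≤ 1 ∧
        Real.exp (4 * (800 * (((4 : ℕ) : ℝ) + 1) ^ 2 * (((4 : ℕ) : ℝ) + 4)) * α₀) *
            (1 + 8 * (131072 * (((4 : ℕ) : ℝ) + 1) ^ 2) * (B₁' * (α₀ + α₁))) ≤ 2 ∧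
        2 * (B₁' * (α₀ + α₁)) ≤ c3 4 L ∧ ((4 : ℕ) : ℝ) * L * α₁ ≤ 1 / 8 ∧ α₀ ≤ cP ∧ α₁ ≤ cP ∧ B₁' * (α₀ + α₁) ≤ cP ∧
        2 * (B₁' * (α₀ + α₁)) ^ 2 + 20 * ((4 : ℕ) : ℝ) * α₀ * (B₁' * (α₀ + α₁)) + 2 * C₂ * (B₁' * (α₀ + α₁)) ^ 2 ≤ α₀ + α₁) →
      ∀ ⦃b' c' : ℝ⦄, 0 ≤ b' → 0 ≤ c' →
      2 ^ 15 * ((4 : ℝ) + 1) ^ 2 * ((4 : ℝ) + 4) ^ 2 * (L : ℝ) ^ 2 * b' ≤ 1 →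
      23040 * (4 : ℝ) ^ 4 * (frameC 4 L + 4) ^ 3 * (c' + curConst 4 L * b' ^ 2) ≤ 1 →
      ∀ ⦃α : ℝ⦄, 0 < α → C0 4 * α ≤ 1 / 3 → 2 * α ≤ c2' 4 L → 11 * (4 : ℝ) ^ 2 * α ≤ 1 / 6 → α + 11 * (4 : ℝ) ^ 2 * α ≤ c₁' →
      b' + 226 * (8 * ((4 : ℝ) + 1) * ((4 : ℝ) + 4)) ^ 2 * b' ^ 2 < α → 4 * ((4 : ℝ) - 1) * (c' + curConst 4 L * b' ^ 2) < α →
      ∀ ⦃Mc : ℝ⦄, 0 ≤ Mc → (Mc + 1) * (b' + 226 * (8 * ((4 : ℝ) + 1) * ((4 : ℝ) + 4)) ^ 2 * b' ^ 2) ≤ 1 / 2 →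
      ∀ (𝒬 : ℕ → Set (Set (Site 4) × ℕ)), (∀ k, ∀ q ∈ 𝒬 k, q.2 ≤ k ∧ ∃ y : Site 4, ∀ z ∈ q.1, (l1 (z - y) : ℝ) ≤ Mc * (L : ℝ) ^ q.2) →
      ∀ ⦃C335 : ℝ⦄, 2 * (Mc + 1) * (b' + 226 * (8 * ((4 : ℝ) + 1) * ((4 : ℝ) + 4)) ^ 2 * b' ^ 2) + 2 * Mc * (2 * (c' + curConst 4 L * b' ^ 2)) +
        4 * Mc * (1 + 2 * Mc) * (b' + 226 * (8 * ((4 : ℝ) + 1) * ((4 : ℝ) + 4)) ^ 2 * b' ^ 2) ^ 2 < C335 →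
      ∀ ⦃ε s₁ b s₂ : ℝ⦄, 0 < ε → ε ≤ r → ε < α → 0 ≤ s₁ → s₁ ≤ r → 0 ≤ b → b ≤ ε / 2 →
      5 * ((4 : ℕ) : ℝ) * L * inp.B₀ * (α + 11 * (4 : ℝ) ^ 2 * α) ≤ s₁ →
      5 * ((4 : ℕ) : ℝ) * L * inp.B₀ * (α + 11 * (4 : ℝ) ^ 2 * α) +
          2 * (b' + 226 * (8 * ((4 : ℝ) + 1) * ((4 : ℝ) + 4)) ^ 2 * b' ^ 2) * s₁ ≤ s₁ →
      5 * ((4 : ℕ) : ℝ) * L * inp.B₀ * (α + 11 * (4 : ℝ) ^ 2 * α) + 16 * (b' + 226 * (8 * ((4 : ℝ) + 1) * ((4 : ℝ) + 4)) ^ 2 * b' ^ 2) *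
          (5 * ((4 : ℕ) : ℝ) * L * inp.B₀ * (α + 11 * (4 : ℝ) ^ 2 * α)) ≤ s₁ →
      5 * ((4 : ℕ) : ℝ) * L * B₀β * (α + 11 * (4 : ℝ) ^ 2 * α) + 8 * (b' + 226 * (8 * ((4 : ℝ) + 1) * ((4 : ℝ) + 4)) ^ 2 * b' ^ 2) *
          (5 * ((4 : ℕ) : ℝ) * L * inp.B₀ * (α + 11 * (4 : ℝ) ^ 2 * α)) ≤ s₂ →
      B8.Thm4Body c₁ B₁' (fun i : {i : ZdIdx 4 L // i.Ω 0 = Set.univ} => (zdGF3 (Matrix n n ℂ) L 1 len i.1).toGFData) →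
      B8.Prop3Body cP 4 (L : ℝ) C₂ inp B₀β (fun i : {i : ZdIdx 4 L // i.Ω 0 = Set.univ} => (zdGF3 (Matrix n n ℂ) L 1 len i.1).toGFData2) →
      ∀ {dom : _root_.Set (Site 4 → Fin 4 → (Matrix n n ℂ)ˣ)},
        LeafH3sup 4 L N ε b' c' dom →
        NE3EnergyRateWCov 4 (sfClass 4 L N ε) L N b g C s₁ s₂ dom := by
  letI : CStarAlgebra (Matrix n n ℂ) := {}
  obtain ⟨r, hr0, hr⟩ := n16_of_thm4Zd_print (n := n) hL hN
  refine ⟨r, hr0, fun g hg => ?_⟩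
  obtain ⟨C, hC0, hC⟩ := hr hg
  refine ⟨C, hC0, fun c₁ c₁' B₁' cP C₂ B₀β inp len hlen hlen1 hB₁' hBB h16 hwin b' c' hb' hc' hRb hcF α hα hA3 hA2 hAs hAc hb'α hc'α Mc hMc
    hMcα 𝒬 h𝒬 C335 hC335 ε s₁ b s₂ hε hεr hεα hs₁ hs₁r hb hbh hss hgrad hℓ hhol hT hP dom h3 => ?_⟩
  have hB0 : 0 ≤ 5 * ((4 : ℕ) : ℝ) * L * inp.B₀ := by have := inp.B₀_pos.le; positivity
  have hT4 := thm4TorusAt_print_of_leaf (d := 4) (by norm_num) hL zero_le_one hlen hlen1 hB₁' hBB hwin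
    (fun k => Reg335Zd (((L : ℝ) ^ k)⁻¹) L (𝒬 k) C335) hT hP
  exact hC c₁' (5 * ((4 : ℕ) : ℝ) * L * inp.B₀) (5 * ((4 : ℕ) : ℝ) * L * B₀β) hB0 h16 hb' hc' hRb hcF hα hA3 hA2 hAs hAc hb'α hc'α hMc
    hMcα 𝒬 h𝒬 hC335 hε hεr hεα hs₁ hs₁r hb hbh hss hgrad hℓ hhol hT4 h3

end Matrices

end

end Summit.QuantumFields.YangMills.BalabanUVNodes.N16.OfLeaf
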